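import Summits.ResolutionOfSingularities.ResolutionOfSingularities.Theorems.WeightedInvariantELadderOneBaseDim
import Summits.ResolutionOfSingularities.ResolutionOfSingularities.Theorems.WeightedInvariantELadderOneStageInv
import HarnessLib

/-!
# e-ladder, rung `e = 1`: the START stage under the reshaped invariant `Inv'`

Route `ResolutionOfSingularities/WeightedInvariant`, crux `Theses.WeightedInvariant.HypersurfaceCentreConstruction`
(stmt-ResolutionOfSingularities-19897), door line `e-ladder`, rung `e = 1`. The line owner (res-D-pv-025 AS
res-L1-w43-stub-10, cell res-hironaka STATUS 2026-08-27T08:22:30Z) adopted res-type-017's reshaped invariant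
`Stage.Inv' = (I0) ∧ (I1) ∧ (I2w)` (`Theorems/WeightedInvariantELadderOneStageInv.lean`). This def-free file is the
`Inv'`-twin of `stub_e1_base` (p508242): a hypersurface pair whose hypersurface is a curve is a stage of rank `0`
satisfying `Inv'` — `stub_e1_base_dim` (p514001) supplies `Inv` and the dimension datum (I0), and
`Stage.inv'_of_inv` assembles them.

Helper, `--supports stmt-ResolutionOfSingularities-19897`. Nothing here is a claim about Hironaka's problem or about
resolution in positive characteristic; the rung is OURS.
-/

noncomputable section

set_option linter.dupNamespace false -- mandated namespace of this single-conjunct summit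

open CategoryTheory AlgebraicGeometry TopologicalSpace
open Literature.AlgebraicGeometry.Resolution
open Summit.ResolutionOfSingularities.ResolutionOfSingularities.Theorems

namespace Summit.ResolutionOfSingularities.ResolutionOfSingularities.Theorems.ELadderOne

variable {k : Type} [Field k]

/-- **`stub_e1_base` under `Inv'`.** A hypersurface pair whose hypersurface is a CURVE is a stage of rank `j = 0`
satisfying the reshaped invariant `Inv' = (I0) ∧ (I1) ∧ (I2w)`: the stage of `stub_e1_base` has `Inv` (hence (I1) and
(I2) on all charts, a fortiori (I2w)) and dimension `dim X = 1 = j + 1` (I0). [folklore] -/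
theorem stub_e1_base' (P : HypersurfacePair k)
    (hP : topologicalKrullDim P.X.subscheme = ((1 : ℕ) : WithBot ℕ∞)) :
    ∃ S : Stage k, S.Inv' ∧ S.j = 0 ∧ S.toPair = P := by
  obtain ⟨S, hInv, h0, hj, hSP⟩ := stub_e1_base_dim P hP
  exact ⟨S, S.inv'_of_inv h0 hInv, hj, hSP⟩

end Summit.ResolutionOfSingularities.ResolutionOfSingularities.Theorems.ELadderOne

end
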